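import Literature.AlgebraicGeometry.Resolution.PointBlowupIFPGiraud
import Literature.AlgebraicGeometry.Resolution.PointBlowupIFPUnitProp4
import HarnessLib

/-!
# Kawanoue–Matsuki 2016, Prop. 4 (2), corner model: `μ̃` does not increase along ANY sequence of point blow-ups at
# equimultiple points — no per-state hypothesis

`Literature/AlgebraicGeometry/Resolution/PointBlowupIFPGiraudChain.lean` (cell `res-hironaka`, D-0124 rescue, literature
seat `res-rescue-harvest-1` g6).  Puts together `IFPState.muTilde_step_le` of `PointBlowupIFPUnitProp4.lean` (Prop. 4 (2)
at a closed point, under the hypothesis `hsing` = «`P ∈ Sing(ℛ)`») and the Giraud-lemma invariant of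
`PointBlowupIFPGiraud.lean` (`IFPState.gen_init_mem_span`, `gen_step_mem_span`, `level_le_ordZero_gen_of_mem_span`:
`hsing` is born at the root and preserved by every transformation at an equimultiple point).

**Source.** H. Kawanoue, K. Matsuki, *Resolution of singularities of an idealistic filtration in dimension 3 after
Benito–Villamayor*, Adv. Stud. Pure Math. **70** (2016) 115–214 = arXiv:1205.4556, §4.1 and **Proposition 4 (2)**
(«When `σ = σ̃`, the value of the invariant `μ̃` does not increase»; its standing hypothesis «`C ⊂ Sing(Comp(ℛ))`»,
printed proof arXiv chunk p0023 L38–49) [KawanoueMatsuki2016]; Giraud's lemma [Giraud1975],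
[BravoGarciaEscamillaVillamayor2012, Lemma 4.6].

**What is proved.** `IFPState.muTilde_succ_le_along`: characteristic `p`, `q = p^e`, any finite number of residual
variables; along ANY sequence of point blow-ups of `x^q + F(y)` at equimultiple points (`s (n+1) = step q (j n) (b n) (s n)`,
`b n (j n) = 0`, `IsEquimultiplePoint q (j n) (b n) (s n)`), from a root with `q ≤ ord₀ F`, the transported IFP corner
states `t (n+1) = (t n).step q (j n) (b n)`, `t 0 = init q F`, satisfy `μ̃(t (n+1)) ≤ μ̃(t n)` for every `n` — NO
hypothesis on the intermediate states.  `IFPState.muTilde_step_le_of_gen_mem_span` is the one-step form.  NOT covered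
(and not claimed): positive-dimensional centres, `σ`-drops (Prop. 4 (1)), the invariant `s` (Prop. 4 (3)), the horizontal
direction (Prop. 3), termination.  Every reading of the model as an instance of the printed statement is OURS; nothing of
Hironaka's 2017 manuscript is referred to or asserted.

## References
* H. Kawanoue, K. Matsuki, Adv. Stud. Pure Math. 70 (2016) 115–214 = arXiv:1205.4556, §4.1, Prop. 4. [KawanoueMatsuki2016]
* J. Giraud, Ann. Sci. ÉNS (4) 8 (1975) 201–234. [Giraud1975]
* A. Bravo, M. L. García-Escamilla, O. Villamayor, Indiana Univ. Math. J. 61 (2012), Lemma 4.6. [BravoGarciaEscamillaVillamayor2012]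
-/

noncomputable section

open MvPolynomial Finset

open scoped BigOperators

namespace Literature.AlgebraicGeometry.Resolution

open Literature.AlgebraicGeometry.Resolution.Hauser2010

section Chain

variable {σ : Type*} {K : Type*} [Field K] [Fintype σ] [DecidableEq σ] [DecidableEq K]

/-- **Kawanoue–Matsuki 2016, Prop. 4 (2), corner model, along ANY sequence of point blow-ups at equimultiple points —
no per-state hypothesis.** Characteristic `p`, `q = p^e`, any finite number of residual variables. Let
`s 0, s 1, …` be the states of `x^q + F(y)` under point blow-ups (`s (n+1) = step q (j n) (b n) (s n)`, points `b n` on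
the new exceptional divisor, `b n (j n) = 0`) at which the order stays `q` (`IsEquimultiplePoint`), starting from
`q ≤ ord₀ (s 0).F`, and let `t n` be the IFP corner states transported along (`t 0 = init q (s 0).F`,
`t (n+1) = (t n).step q (j n) (b n)`). Then `μ̃(t (n+1)) ≤ μ̃(t n)` for every `n`: the unit `μ̃` never increases along
the chain. (Prop. 4 (2)'s standing hypothesis «`C ⊂ Sing(Comp ℛ)`» is DISCHARGED here by Giraud's lemma in the
chart, `gen_step_mem_span`; what is NOT covered: positive-dimensional centres, `σ`-drops, the invariant `s`, the
horizontal direction, termination.) [cite: KawanoueMatsuki2016, Proposition 4 (2)] -/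
theorem PointBlowup.IFPState.muTilde_succ_le_along (p : ℕ) [Fact p.Prime] [CharP K p] (e : ℕ)
    (s : ℕ → PointBlowup.State σ K) (t : ℕ → PointBlowup.IFPState σ K) (j : ℕ → σ) (b : ℕ → σ → K)
    (hb : ∀ n, b n (j n) = 0)
    (hs : ∀ n, s (n + 1) = PointBlowup.step (p ^ e) (j n) (b n) (s n))
    (ht : ∀ n, t (n + 1) = (t n).step (p ^ e) (j n) (b n))
    (h0 : t 0 = PointBlowup.IFPState.init (p ^ e) (s 0).F)
    (hF : ((p ^ e : ℕ) : ℕ∞) ≤ ordZero (s 0).F)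
    (hequi : ∀ n, PointBlowup.IsEquimultiplePoint (p ^ e) (j n) (b n) (s n)) (n : ℕ) :
    (t (n + 1)).muTilde (p ^ e) ≤ (t n).muTilde (p ^ e) := by
  -- the invariant along the chain
  have hidx : ∀ n, (t n).idx = (PointBlowup.IFPState.init (p ^ e) (s 0).F).idx := by
    intro n
    induction n with
    | zero => rw [h0]
    | succ n ih => rw [ht n]; exact ih
  have hlev : ∀ n, ∀ J ∈ (t n).idx, 0 < J.degree ∧ J.degree < p ^ e := by
    intro n J hJ
    rw [hidx n] at hJ
    exact PointBlowup.IFPState.degree_lt_of_mem_derivIndices hJ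
  have hinv : ∀ n, ((p ^ e : ℕ) : ℕ∞) ≤ ordZero (s n).F ∧
      ∀ J ∈ (t n).idx, (t n).gen J ∈
        Ideal.span ((fun M => Resolution.hasseDeriv K M (s n).F) '' {M | 0 < M.degree ∧ M.degree ≤ J.degree}) := by
    intro n
    induction n with
    | zero =>
      refine ⟨hF, ?_⟩
      rw [h0]
      exact PointBlowup.IFPState.gen_init_mem_span (p ^ e) (s 0).F
    | succ n ih =>
      refine ⟨?_, ?_⟩
      · rw [hs n]; exact PointBlowup.le_ordZero_step_of_isEquimultiplePoint _ _ _ _ (hequi n)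
      · rw [hs n, ht n]
        exact PointBlowup.IFPState.gen_step_mem_span p e (j n) (b n) (s n) (t n) (hlev n) ih.1 ih.2
  rw [ht n]
  exact PointBlowup.IFPState.muTilde_step_le (p ^ e) (j n) (b n) (hb n) (t n) (fun J hJ => (hlev n J hJ).2)
    (PointBlowup.IFPState.level_le_ordZero_gen_of_mem_span (p ^ e) (t n) (hinv n).1 (hinv n).2)

/-- **One transformation, hypotheses only on the residual**: for a corner state `t` carrying the invariant over a
residual `G` with `q ≤ ord₀ G` (e.g. any state reached along an equimultiple chain), `μ̃(t.step q j b) ≤ μ̃(t)` at every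
closed point `b` of the new exceptional divisor. [cite: KawanoueMatsuki2016, Proposition 4 (2)] -/
theorem PointBlowup.IFPState.muTilde_step_le_of_gen_mem_span (p : ℕ) [Fact p.Prime] [CharP K p] (e : ℕ) (j : σ)
    (b : σ → K) (hbj : b j = 0) (t : PointBlowup.IFPState σ K) {G : MvPolynomial σ K}
    (hord : ((p ^ e : ℕ) : ℕ∞) ≤ ordZero G) (hlev : ∀ J ∈ t.idx, J.degree < p ^ e)
    (hgen : ∀ J ∈ t.idx, t.gen J ∈
      Ideal.span ((fun M => Resolution.hasseDeriv K M G) '' {M | 0 < M.degree ∧ M.degree ≤ J.degree})) :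
    (t.step (p ^ e) j b).muTilde (p ^ e) ≤ t.muTilde (p ^ e) :=
  PointBlowup.IFPState.muTilde_step_le (p ^ e) j b hbj t hlev
    (PointBlowup.IFPState.level_le_ordZero_gen_of_mem_span (p ^ e) t hord hgen)

end Chain

end Literature.AlgebraicGeometry.Resolution

end
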